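import Literature.NumberTheory.Transcendental.KZDilationRationalNormalForm
import HarnessLib
import HarnessLib.Audit

/-!
# SoloInformed — Baker normal form for rational functions with ALGEBRAIC coefficients

Solo programme `solo-KontsevichZagierPeriods-informed`, session s112, file 13.

The tree's `KZ.BakerSectorComplex.exists_bakerNormalForm` [folklore; partial fractions] is stated
for `P, Q ∈ ℚ[X]`.  Its proof runs over `ℚ̄ = algebraicClosure ℚ ℂ` anyway, so the same argument
gives the normal form for ARBITRARY polynomials `P, Q ∈ ℚ̄[X]` (complex algebraic coefficients),
with the real part of the quotient on the left:

**Theorem** (`soloInformed_exists_bakerNormalForm_alg`). Let `P, Q ∈ ℚ̄[X]` with `Q` non-vanishing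
at the real points of an open interval `(a,b) ∋ 0`. Then on `(a,b)`
  `Re (P(x)/Q(x)) = ρ'(x) + Σ_k (γ_k(−p_k + (p_k²+q_k²)x) + δ_k q_k)/((1 − p_k x)² + (q_k x)²)`
with `ρ` Nash on `(a,b)`, real algebraic `p_k, q_k, γ_k, δ_k` and the slit condition
`0 < 1 − p_k x ∨ q_k x ≠ 0` on `(a,b)`.  (Kontsevich–Zagier, *Periods* (2001), §1.1: in the
definition of periods "rational" may be replaced by "algebraic"; this file is the one-variable
partial-fraction engine for that replacement, consumed by file 14.)

Differences from the `ℚ[X]` proof: the leading coefficient is a complex algebraic number (no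
realness is needed because the left side is a real part), and the polynomial part is
`Re((quo/lc)(x)) = Σ_i Re(quo_i/lc) x^i`.

References: A. Baker, *Transcendental Number Theory* (1975), Ch. 2 (context); M. Kontsevich,
D. Zagier, *Periods* (2001), §1.1; partial fractions [folklore].
-/

noncomputable section

open Set Filter Complex Polynomial
open scoped BigOperators Topology Real ComplexConjugate

namespace Summit.KontsevichZagierPeriods.KontsevichZagierPeriods.Theorems

open Literature.ModelTheory.ExponentialFields
open Literature.NumberTheory.Transcendental Literature.NumberTheory.Transcendental.KZ.BakerSectorComplex

/-- **Baker normal form of a rational function with algebraic (complex) coefficients**, real part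
on a real interval around `0`. See the module docstring. [folklore; Kontsevich–Zagier 2001 §1.1] -/
theorem soloInformed_exists_bakerNormalForm_alg (PL QL : (algebraicClosure ℚ ℂ)[X]) {a b : ℝ}
    (ha : a < 0) (hb : 0 < b) (hI : IsSemialgebraic ℚ {t : Fin 1 → ℝ | t 0 ∈ Ioo a b})
    (hQ : ∀ x ∈ Ioo a b,
      (QL.map (algebraMap (algebraicClosure ℚ ℂ) ℂ)).eval (x : ℂ) ≠ 0) :
    ∃ (ρ : ℝ → ℝ) (A : ℕ) (p q γ δ : Fin A → ℝ),
      IsSemialgebraicFunOn ℚ {t : Fin 1 → ℝ | t 0 ∈ Ioo a b} (fun t => ρ (t 0)) ∧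
      (∀ x ∈ Ioo a b, AnalyticAt ℝ ρ x) ∧
      (∀ k, IsAlgebraic ℚ (p k)) ∧ (∀ k, IsAlgebraic ℚ (q k)) ∧
      (∀ k, IsAlgebraic ℚ (γ k)) ∧ (∀ k, IsAlgebraic ℚ (δ k)) ∧
      (∀ k, ∀ x ∈ Ioo a b, 0 < 1 - p k * x ∨ q k * x ≠ 0) ∧
      ∀ x ∈ Ioo a b,
        ((PL.map (algebraMap (algebraicClosure ℚ ℂ) ℂ)).eval (x : ℂ) /
            (QL.map (algebraMap (algebraicClosure ℚ ℂ) ℂ)).eval (x : ℂ)).re =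
        deriv ρ x + ∑ k, (γ k * (-p k + (p k ^ 2 + q k ^ 2) * x) + δ k * q k) /
          ((1 - p k * x) ^ 2 + (q k * x) ^ 2) := by
  classical
  have h0I : (0:ℝ) ∈ Ioo a b := ⟨ha, hb⟩
  haveI hAC : IsAlgClosed (algebraicClosure ℚ ℂ) :=
    (algebraicClosure.isAlgClosure ℚ ℂ).isAlgClosed
  set φ : (algebraicClosure ℚ ℂ) →+* ℂ := algebraMap (algebraicClosure ℚ ℂ) ℂ with hφ
  have hφalg : ∀ z : algebraicClosure ℚ ℂ, IsAlgebraic ℚ (φ z) := fun z =>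
    mem_algebraicClosure_iff.mp z.2
  have hQL0 : QL ≠ 0 := by
    intro h; exact hQ 0 h0I (by simp [h])
  -- the (complex, algebraic, non-zero) leading coefficient
  set lc : ℂ := φ QL.leadingCoeff with hlcdef
  have hlc0 : lc ≠ 0 := by
    rw [hlcdef]
    exact (map_ne_zero_iff φ φ.injective).mpr (leadingCoeff_ne_zero.mpr hQL0)
  have hlcalg : IsAlgebraic ℚ lc⁻¹ := (hφalg _).inv
  -- partial fractions over `ℚ̄`, evaluated in `ℂ`
  obtain ⟨quo, c, hpf⟩ := exists_partialFraction_map_eval φ PL QL hQL0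
  set s : Finset (algebraicClosure ℚ ℂ) := QL.roots.toFinset with hs
  set n : algebraicClosure ℚ ℂ → ℕ := fun α => QL.rootMultiplicity α with hn
  have hxα : ∀ α ∈ s, ∀ x ∈ Ioo a b, (x : ℂ) ≠ φ α := by
    intro α hα x hx h
    apply hQ x hx
    have hroot : IsRoot QL α := (mem_roots hQL0).mp (Multiset.mem_toFinset.mp hα)
    rw [h, eval_map, eval₂_hom, hroot.eq_zero, map_zero]
  have hα0 : ∀ α ∈ s, φ α ≠ 0 := by
    intro α hα h
    exact hxα α hα 0 h0I (by simpa using h.symm)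
  have hnpos : ∀ α ∈ s, 0 < n α := fun α hα =>
    (rootMultiplicity_pos hQL0).mpr ((mem_roots hQL0).mp (Multiset.mem_toFinset.mp hα))
  -- index the roots by `Fin A`
  set A : ℕ := s.card with hA
  set e : Fin A ≃ s := s.equivFin.symm with he
  set αk : Fin A → ℂ := fun k => φ (e k : algebraicClosure ℚ ℂ) with hαk
  have hαks : ∀ k, ((e k : algebraicClosure ℚ ℂ)) ∈ s := fun k => (e k).2
  have hαk0 : ∀ k, αk k ≠ 0 := fun k => hα0 _ (hαks k)
  have hxαk : ∀ k, ∀ x ∈ Ioo a b, (x : ℂ) ≠ αk k := fun k x hx => hxα _ (hαks k) x hx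
  have hαkalg : ∀ k, IsAlgebraic ℚ (αk k) := fun k => hφalg _
  -- residues (divided by the leading coefficient)
  set d : Fin A → ℂ := fun k => φ (c (e k) (n (e k) - 1)) / lc with hd
  have hdalg : ∀ k, IsAlgebraic ℚ (d k) := fun k => by
    simp only [hd, div_eq_mul_inv]
    exact (hφalg _).mul hlcalg
  -- constants of the higher pole terms: `κ_{k,j} = −φ(c_{k,j})/(lc · m)`, `m = N_k − 1 − j ≥ 1`
  set N : Fin A → ℕ := fun k => n (e k) with hN
  have hNpos : ∀ k, 0 < N k := fun k => hnpos _ (hαks k)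
  set κ : Fin A → ℕ → ℂ := fun k j =>
    -(φ (c (e k) j)) / (lc * ((N k - 1 - j : ℕ) : ℂ)) with hκ
  have hκalg : ∀ k j, IsAlgebraic ℚ (κ k j) := fun k j => by
    simp only [hκ, div_eq_mul_inv, mul_inv]
    refine ((hφalg _).neg).mul (hlcalg.mul ?_)
    simpa using isAlgebraic_algebraMap (R := ℚ) (A := ℂ) (((N k - 1 - j : ℕ) : ℚ)⁻¹)
  -- the polynomial part: `quo' = quo/lc`, `r_i = Re(quo'_i)`
  set quo' : ℂ[X] := quo.map φ * Polynomial.C lc⁻¹ with hquo'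
  set M : ℕ := quo'.natDegree + 1 with hM
  set r : ℕ → ℝ := fun i => (quo'.coeff i).re with hr
  have hralg : ∀ i, IsAlgebraic ℚ (r i) := fun i => by
    simp only [hr, hquo', coeff_mul_C, coeff_map]
    exact (isAlgebraic_re_im ((hφalg _).mul hlcalg)).1
  -- the Nash primitive `ρ`
  set ρ : ℝ → ℝ := fun x => (∑ i ∈ Finset.range M, r i / ((i:ℝ) + 1) * x ^ (i + 1)) +
    ∑ k, ∑ j ∈ Finset.range (N k - 1), (κ k j * ((((x : ℂ) - αk k) ^ (N k - 1 - j)))⁻¹).re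
    with hρ
  -- its derivative on `(a,b)`
  have hρd : ∀ x ∈ Ioo a b, HasDerivAt ρ ((∑ i ∈ Finset.range M, r i * x ^ i) +
      ∑ k, ∑ j ∈ Finset.range (N k - 1),
        (-((N k - 1 - j : ℕ) : ℂ) * κ k j * ((((x : ℂ) - αk k) ^ (N k - 1 - j + 1)))⁻¹).re) x := by
    intro x hx
    refine HasDerivAt.add ?_ ?_
    · refine HasDerivAt.fun_sum fun i _ => ?_
      have h := (hasDerivAt_pow (i + 1) x).const_mul (r i / ((i:ℝ) + 1))
      refine h.congr_deriv ?_
      have hi : ((i:ℝ) + 1) ≠ 0 := by positivity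
      simp only [Nat.add_sub_cancel]
      push_cast
      field_simp
    · refine HasDerivAt.fun_sum fun k _ => HasDerivAt.fun_sum fun j _ => ?_
      exact hasDerivAt_re_const_mul_inv_pow (hxαk k x hx) _
  refine ⟨ρ, A, fun k => (αk k)⁻¹.re, fun k => (αk k)⁻¹.im, fun k => (d k).re, fun k => (d k).im,
    ?_, ?_, fun k => (isAlgebraic_re_im (hαkalg k).inv).1,
    fun k => (isAlgebraic_re_im (hαkalg k).inv).2,
    fun k => (isAlgebraic_re_im (hdalg k)).1, fun k => (isAlgebraic_re_im (hdalg k)).2, ?_, ?_⟩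
  · -- `ρ` is semialgebraic
    have hpow : ∀ i : ℕ, IsSemialgebraicFunOn ℚ {t : Fin 1 → ℝ | t 0 ∈ Ioo a b}
        (fun t => t 0 ^ i) := by
      intro i
      simpa using isSemialgebraicFunOn_aeval hI (MvPolynomial.X 0 ^ i : MvPolynomial (Fin 1) ℚ)
    refine IsSemialgebraicFunOn.fun_add ?_ ?_
    · refine IsSemialgebraicFunOn.fun_finsetSum _ hI fun i _ => ?_
      refine (isSemialgebraicFunOn_const_of_isAlgebraic hI ?_).fun_mul (hpow (i + 1))
      simp only [div_eq_mul_inv]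
      refine (hralg i).mul ?_
      simpa using isAlgebraic_algebraMap (R := ℚ) (A := ℝ) (((i:ℚ) + 1)⁻¹)
    · refine IsSemialgebraicFunOn.fun_finsetSum _ hI fun k _ =>
        IsSemialgebraicFunOn.fun_finsetSum _ hI fun j _ => ?_
      exact (isSemialgebraicFunOn_re_im_const_mul_inv_pow hI (hαkalg k) (hκalg k j) _).1
  · -- `ρ` is analytic
    intro x hx
    refine AnalyticAt.add ?_ ?_
    · exact Finset.analyticAt_fun_sum _ fun i _ => analyticAt_const.mul (analyticAt_id.pow _)
    · exact Finset.analyticAt_fun_sum _ fun k _ => Finset.analyticAt_fun_sum _ fun j _ =>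
        analyticAt_re_const_mul_inv_pow (hxαk k x hx)
  · -- slit condition
    intro k x hx
    exact slit_of_inv_pole ha hb (hαk0 k) (fun y hy => hxαk k y hy) hx
  · -- the identity
    intro x hx
    rw [(hρd x hx).deriv]
    -- the simple pole terms
    have hS : ∀ k, (d k / ((x : ℂ) - αk k)).re =
        ((d k).re * (-(αk k)⁻¹.re + ((αk k)⁻¹.re ^ 2 + (αk k)⁻¹.im ^ 2) * x) +
          (d k).im * (αk k)⁻¹.im) /
          ((1 - (αk k)⁻¹.re * x) ^ 2 + ((αk k)⁻¹.im * x) ^ 2) := fun k =>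
      re_div_sub_eq_residue_term (hαk0 k)
        (slit_of_inv_pole ha hb (hαk0 k) (fun y hy => hxαk k y hy) hx)
    simp_rw [← hS]
    -- the higher pole terms: `−m κ_{k,j} = φ(c_{k,j})/lc`
    have hH : ∀ k, ∀ j ∈ Finset.range (N k - 1),
        (-((N k - 1 - j : ℕ) : ℂ) * κ k j * ((((x : ℂ) - αk k) ^ (N k - 1 - j + 1)))⁻¹) =
          φ (c (e k) j) / ((x : ℂ) - αk k) ^ (N k - j) / lc := by
      intro k j hj
      have hj' : j < N k - 1 := Finset.mem_range.mp hj
      have hm0 : ((N k - 1 - j : ℕ) : ℂ) ≠ 0 := by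
        exact_mod_cast (Nat.sub_pos_of_lt hj').ne'
      have hexp : N k - 1 - j + 1 = N k - j := by omega
      rw [hexp, hκ]
      have hxk := pow_sub_ne_zero (hxαk k x hx) (N k - j)
      field_simp
    -- left-hand side through the partial fraction decomposition
    rw [hpf (x : ℂ) (hQ x hx)]
    rw [add_div, Finset.sum_div, Complex.add_re, Complex.re_sum]
    -- polynomial part
    have hpoly : ((quo.map φ).eval (x : ℂ) / lc).re = ∑ i ∈ Finset.range M, r i * x ^ i := by
      have hq' : (quo.map φ).eval (x : ℂ) / lc = quo'.eval (x : ℂ) := by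
        rw [hquo', eval_mul, eval_C, div_eq_mul_inv]
      rw [hq', re_eval_ofReal]
    rw [hpoly, add_assoc, ← Finset.sum_add_distrib]
    congr 1
    -- pole part: reindex `α ∈ s` by `k : Fin A` and split off the simple pole
    rw [← Finset.sum_coe_sort s, ← Equiv.sum_comp e]
    refine Finset.sum_congr rfl fun k _ => ?_
    have hsplit : Finset.range (QL.rootMultiplicity (e k : algebraicClosure ℚ ℂ)) =
        Finset.range (N k - 1 + 1) := by
      rw [Nat.sub_add_cancel (hNpos k)]
    rw [Finset.sum_div, Complex.re_sum, hsplit, Finset.sum_range_succ]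
    congr 1
    · refine Finset.sum_congr rfl fun j hj => ?_
      rw [hH k j hj]
    · -- the simple pole
      have hN1 : QL.rootMultiplicity (e k : algebraicClosure ℚ ℂ) - (N k - 1) = 1 := by
        show N k - (N k - 1) = 1
        have := hNpos k
        omega
      rw [hN1, pow_one]
      simp only [hd, hαk, hN, hn]
      rw [div_right_comm]

end Summit.KontsevichZagierPeriods.KontsevichZagierPeriods.Theorems
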